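import Literature.AlgebraicGeometry.HodgeTheory.SpecialisedHypersurfaceFamilyPoints
import Literature.AlgebraicGeometry.HodgeTheory.UniversalHypersurfaceEhresmann
import Literature.AlgebraicGeometry.HodgeTheory.DiagonalSymmetry
import Literature.AlgebraicGeometry.HodgeTheory.CompleteIntersectionHilbertFunctionSign
import Literature.Computability.AlgebraicComplexity.SmoothFormAnnihilatorSemisimple
import Literature.AlgebraicGeometry.Motives.AlgPointsAffineSpaceProofs
import Literature.NumberTheory.Transcendental.Analytification
import HarnessLib

/-!
# The diagonal-torus family `b ↦ X_{F(b • x)}` through a smooth hypersurface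

Family `hodge`, layer `Literature/AlgebraicGeometry/HodgeTheory`; theorems and concrete definitions only (no
named fact). Written by the prover seat `hodge-nonav-19716-p2` (g6) for crux K1-B
`VeryGeneralSignCommutatorsInHg` of `Summits/HodgeConjecture/HodgeConjecture/Theses/SignSymmetricPowers.lean`
(stmt-HodgeConjecture-19716): first file of the proof that **every diagonal automorphism `[z] ↦ [a • z]`
(`a ∈ diagonalStabilizer F`) of a smooth hypersurface `X_F ⊂ ℙⁿ⁺¹` is a monodromy transformation of the
universal family of smooth degree-`d` hypersurfaces** (the torus trick: the diagonal torus `T = (ℂ^×)^{n+2}` is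
path connected and acts on the space of forms, Katz 2009 §3; Carlson–Toledo 1999 §2 for the cyclic-cover case,
which is the tree's `CyclicCoverScaling.deck_mem_ratMonodromyGroup`). This file sets up the SUB-FAMILY over the
torus:

* §1 `torusSpz d F : ℂ[a_m] → ℂ[b₀, …, b_{n+1}]`, `a_m ↦ F_m · b^m` — the coefficient specialisation whose form
  at the parameter `b` is the twisted form `F(b • x) = aeval (diagonalSubst b) F` (`evalAt_comp_torusSpz`);
  twisted forms of a nonsingular form of degree `d` are nonsingular of degree `d`
  (`isNonsingularForm_twist`, by the tree's `isNonsingularForm_linSubst`);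
* §2 the specialised family `torusFamily d F = familySpz` (`Motives/SpecialisedHypersurfaceFamily`) over the open
  set `S_T ⊆ 𝔸ⁿ⁺²` of parameters with nonsingular twisted form, its points `torusPoint b` (`b ∈ T`), their
  forms and images `[F(b • x)] ∈ U(ℂ)`;
* §3 the parameter chart `param : S_T(ℂ) → ℂⁿ⁺²`, `t ↦ (t(b_i))_i` — a topological embedding for the strong
  topology (pattern of `Motives/UniversalHypersurfaceBaseChart`: `S_T ⊆ 𝔸ⁿ⁺²` is an open immersion and
  `𝔸ⁿ⁺²(ℂ) ≅ ℂⁿ⁺²`), so that families of points are continuous as soon as their parameters are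
  (`continuous_of_param_comp`);
* §4 the path `torusPath a : s ↦ [F(b_s • x)]`, `b_s = exp(s·log a)`, from `b = 1` to `b = a` in `S_T(ℂ)` —
  NOT a loop upstairs, but a loop downstairs in `U(ℂ)` when `a ∈ diagonalStabilizer F`.

The monodromy computation is in the companion `DiagonalTorusMonodromy`.

## References

* [Katz2009] N. M. Katz, Another look at the Dwork family, Progr. Math. 269 (2009), §3 (the diagonal group acts
  on the family over its parameter space).
* [CarlsonToledo1999] J. A. Carlson, D. Toledo, Discriminant complements and kernels of monodromy representations,
  Duke Math. J. 97 (1999), §2.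
* [VoisinHodgeII2003] C. Voisin, Hodge Theory and Complex Algebraic Geometry II, CUP 2003, §3.1.2, §6.2.1.
* [SerreGAGA1956] J.-P. Serre, GAGA, Ann. Inst. Fourier 6 (1956), §2 n°5.
* [Hartshorne1977] R. Hartshorne, Algebraic Geometry (1977), II Example 7.1.1, I Ex. 5.8.
-/

noncomputable section

namespace Literature.AlgebraicGeometry.HodgeTheory

open CategoryTheory _root_.AlgebraicGeometry MvPolynomial
open _root_.Topology
open Literature.AlgebraicGeometry.Motives Literature.AlgebraicGeometry.Motives.UniversalHypersurface
open Literature.AlgebraicGeometry.HodgeTheory.UniversalHypersurface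
open Literature.NumberTheory.Transcendental

namespace DiagonalTorus

/-! ### §1 The torus specialisation and the twisted forms `F(b • x)` -/

section Spz

variable {n : ℕ} (d : ℕ) (F : MvPolynomial (Fin (n + 2)) ℂ)

/-- **The torus specialisation** `ℂ[a_m | |m| = d] → ℂ[b₀, …, b_{n+1}]`, `a_m ↦ F_m · b^m`: the comorphism of
the orbit map `b ↦ F(b • x)` of the diagonal torus through the form `F`. [cite: Katz2009, §3] -/
def torusSpz : CoeffRing ℂ n d →ₐ[ℂ] MvPolynomial (Fin (n + 2)) ℂ :=
  MvPolynomial.aeval fun m : DegIndex n d => C (coeff m.1 F) * monomial m.1 1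

/-- `torusSpz (a_m) = F_m · b^m`. [cite: Katz2009, §3] -/
theorem torusSpz_X (m : DegIndex n d) : torusSpz d F (X m) = C (coeff m.1 F) * monomial m.1 1 :=
  MvPolynomial.aeval_X _ _

/-- Evaluation of the parameters at `b ∈ ℂⁿ⁺²` (`ℂ[b] → ℂ`). [cite: Katz2009, §3] -/
abbrev evalAt (b : Fin (n + 2) → ℂ) : MvPolynomial (Fin (n + 2)) ℂ →ₐ[ℂ] ℂ := MvPolynomial.aeval b

/-- `evalAt b (b_i) = b_i`. [cite: Katz2009, §3] -/
theorem evalAt_X (b : Fin (n + 2) → ℂ) (i : Fin (n + 2)) : evalAt b (X i) = b i := MvPolynomial.aeval_X _ _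

/-- **The form of the parameter `b` is the twisted form `F(b • x)`**: `(b ↦ ·) ∘ torusSpz = coeffHom (σ_b F)`,
`σ_b F = aeval (diagonalSubst b) F` (coefficientwise `F_m b^m`, the tree's `coeff_aeval_diagonalSubst`).
[cite: Katz2009, §3] -/
theorem evalAt_comp_torusSpz (b : Fin (n + 2) → ℂˣ) :
    (evalAt (fun i => (b i : ℂ))).comp (torusSpz d F) = coeffHom ℂ n d (aeval (diagonalSubst b) F) := by
  refine MvPolynomial.algHom_ext fun m => ?_
  rw [AlgHom.comp_apply, torusSpz_X, map_mul, MvPolynomial.aeval_C, MvPolynomial.aeval_monomial,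
    MvPolynomial.aeval_X, coeff_aeval_diagonalSubst, Finsupp.prod_fintype _ _ (fun i => by rw [pow_zero])]
  simp only [Algebra.algebraMap_self, RingHom.id_apply, map_one, one_mul]
  ring

/-- The twisted form `σ_b F` of a form of degree `d` is a form of degree `d`. [cite: Katz2009, §3] -/
theorem isHomogeneous_twist {F : MvPolynomial (Fin (n + 2)) ℂ} (hF : F.IsHomogeneous d)
    (b : Fin (n + 2) → ℂˣ) : (aeval (diagonalSubst b) F).IsHomogeneous d :=
  (mem_homogeneousSubmodule d _).mp (aeval_diagonalSubst_mem b ((mem_homogeneousSubmodule d F).mpr hF))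

/-- `σ_b` is the linear substitution by the diagonal matrix `diag(b)`. [cite: Hartshorne1977, II Example 7.1.1] -/
theorem aeval_diagonalSubst_eq_linSubst (b : Fin (n + 2) → ℂˣ) (G : MvPolynomial (Fin (n + 2)) ℂ) :
    aeval (diagonalSubst b) G =
      Literature.Computability.AlgebraicComplexity.linSubst (Fin (n + 2)) ℂ
        (Matrix.diagonal fun i => (b i : ℂ)) G := by
  have h : diagonalSubst b = fun i =>
      ∑ j, Matrix.diagonal (fun i => (b i : ℂ)) j i • (X j : MvPolynomial (Fin (n + 2)) ℂ) := by
    funext i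
    rw [diagonalSubst_apply, Finset.sum_eq_single i (fun j _ hj => by rw [Matrix.diagonal_apply_ne _ hj, zero_smul])
      (fun h => absurd (Finset.mem_univ i) h), Matrix.diagonal_apply_eq, MvPolynomial.smul_eq_C_mul]
  rw [h]
  rfl

/-- **Twisted forms of a nonsingular form are nonsingular** (`b ∈ (ℂ^×)^{n+2}`; nonsingularity is invariant under
the invertible linear substitution `diag(b)`, the tree's `isNonsingularForm_linSubst`). [cite: Katz2009, §3] -/
theorem isNonsingularForm_twist {F : MvPolynomial (Fin (n + 2)) ℂ} (hJ : SmoothHypersurface.IsNonsingularForm ℂ F)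
    (b : Fin (n + 2) → ℂˣ) : SmoothHypersurface.IsNonsingularForm ℂ (aeval (diagonalSubst b) F) := by
  rw [aeval_diagonalSubst_eq_linSubst]
  refine Literature.Computability.AlgebraicComplexity.isNonsingularForm_linSubst _ ?_ hJ
  rw [Matrix.det_diagonal, ← Units.coe_prod]
  exact Units.isUnit _

/-- At a diagonal symmetry `a` of `F` the twisted form is `F` itself. [cite: Katz2009, §3] -/
theorem twist_eq_of_mem {F : MvPolynomial (Fin (n + 2)) ℂ} {a : Fin (n + 2) → ℂˣ} (ha : a ∈ diagonalStabilizer F) :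
    aeval (diagonalSubst a) F = F :=
  mem_diagonalStabilizer_iff.mp ha

end Spz

/-! ### §2 The torus family and its points -/

section Family

variable {n : ℕ} (d : ℕ) (F : MvPolynomial (Fin (n + 2)) ℂ)

/-- The base `S_T ⊆ 𝔸ⁿ⁺²` of the torus family: the parameters `b` with `F(b • x)` nonsingular (it contains the
torus `(ℂ^×)^{n+2}` when `F` is nonsingular). [cite: Katz2009, §3] -/
abbrev torusBase : SchemeOver ℂ := baseSpz ℂ n d (torusSpz d F)

/-- The total space of the torus family. [cite: Katz2009, §3] -/
abbrev torusTotal : SchemeOver ℂ := totalSpz ℂ n d (torusSpz d F)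

/-- **The torus family** `b ↦ X_{F(b • x)}` (the universal degree-`d` hypersurface pulled back along `S_T → U`).
[cite: Katz2009, §3] -/
abbrev torusFamily : torusTotal d F ⟶ torusBase d F := familySpz ℂ n d (torusSpz d F)

/-- The projection `𝒴_T → 𝒴_U → ℙⁿ⁺¹` of the total space. [cite: VoisinHodgeII2003, §6.2.1] -/
abbrev totalToProjectiveSpace : torusTotal d F ⟶ Motives.projectiveSpace (n + 1) ℂ :=
  totalSpzToTotal ℂ n d (torusSpz d F) ≫ UniversalHypersurface.toProjectiveSpace ℂ n d

/-- `Rᵏ u_* ℚ` of the torus family is a local system on all of `S_T(ℂ)` (Ehresmann; `n, d ≥ 1`).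
[cite: VoisinHodgeII2003, §3.1.2] -/
theorem torusFamily_locallyTrivial (hn : 1 ≤ n) (hd : 1 ≤ d) :
    IsCohomologicallyLocallyTrivialOn (torusFamily d F) (Set.univ : Set (ComplexPoints (torusBase d F))) :=
  isCohomologicallyLocallyTrivialOn_familySpz n d _ hn hd

variable {d F}
variable (hF : F.IsHomogeneous d) (hJ : SmoothHypersurface.IsNonsingularForm ℂ F)

/-- **The point `b ∈ S_T(ℂ)` of the torus family** for `b ∈ (ℂ^×)^{n+2}` (`F` nonsingular of degree `d`).
[cite: Katz2009, §3] -/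
def torusPoint (b : Fin (n + 2) → ℂˣ) : ComplexPoints (torusBase d F) :=
  pointOfFormSpz ℂ n d (torusSpz d F) (isHomogeneous_twist d hF b) (isNonsingularForm_twist hJ b)
    (evalAt_comp_torusSpz d F b)

/-- Points with equal parameters are equal. [cite: VoisinHodgeII2003, §6.2.1] -/
theorem torusPoint_congr {b b' : Fin (n + 2) → ℂˣ} (h : b = b') : torusPoint hF hJ b = torusPoint hF hJ b' := by
  subst h; rfl

/-- The form of the point `b` is the twisted form `F(b • x)`. [cite: Katz2009, §3] -/
theorem pointFormSpz_torusPoint (b : Fin (n + 2) → ℂˣ) :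
    pointFormSpz ℂ n d (torusSpz d F) (torusPoint hF hJ b) = aeval (diagonalSubst b) F :=
  pointFormSpz_pointOfFormSpz ℂ n d _ _ _ _

/-- The image of the point `b` in `U(ℂ)` is the point `[F(b • x)]`. [cite: VoisinHodgeII2003, §6.2.1] -/
theorem map_toBaseSpz_torusPoint (b : Fin (n + 2) → ℂˣ) :
    AlgPoints.map (toBaseSpz ℂ n d (torusSpz d F)) (torusPoint hF hJ b) =
      pointOfForm ℂ n d (isHomogeneous_twist d hF b) (isNonsingularForm_twist hJ b) :=
  map_toBaseSpz_pointOfFormSpz ℂ n d _ _ _ _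

/-- **At a diagonal symmetry `a` of `F` (and at `b = 1`) the image point is `[F]` itself.**
[cite: Katz2009, §3] -/
theorem map_toBaseSpz_torusPoint_of_mem {a : Fin (n + 2) → ℂˣ} (ha : a ∈ diagonalStabilizer F) :
    AlgPoints.map (toBaseSpz ℂ n d (torusSpz d F)) (torusPoint hF hJ a) = pointOfForm ℂ n d hF hJ := by
  rw [map_toBaseSpz_torusPoint]
  apply pointForm_injective ℂ n d
  rw [pointForm_pointOfForm, pointForm_pointOfForm, twist_eq_of_mem ha]

/-- The coefficient homomorphism of the point `b` is evaluation at `b`. [cite: VoisinHodgeII2003, §6.2.1] -/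
theorem pointHomSpz_torusPoint (b : Fin (n + 2) → ℂˣ) :
    pointHomSpz ℂ n d (torusSpz d F) (torusPoint hF hJ b) =
      CommRingCat.ofHom (evalAt (fun i => (b i : ℂ))).toRingHom :=
  pointHomSpz_pointOfFormSpz ℂ n d _ _ _ _

end Family

/-! ### §3 The parameter chart `S_T(ℂ) ↪ ℂⁿ⁺²` -/

section Chart

variable {n : ℕ} (d : ℕ) (F : MvPolynomial (Fin (n + 2)) ℂ)

/-- **The parameter vector `(t(b_i))_i ∈ ℂⁿ⁺²` of a complex point `t` of `S_T`** (the values of the coefficient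
homomorphism `ℂ[b] → ℂ` of `t` on the variables). [cite: SerreGAGA1956, §2 n°5] -/
def param (t : ComplexPoints (torusBase d F)) : Fin (n + 2) → ℂ :=
  fun i => (pointHomSpz ℂ n d (torusSpz d F) t).hom (X i)

variable {d F} in
/-- The parameter vector of the point `b` is `b`. [cite: SerreGAGA1956, §2 n°5] -/
theorem param_torusPoint (hF : F.IsHomogeneous d) (hJ : SmoothHypersurface.IsNonsingularForm ℂ F)
    (b : Fin (n + 2) → ℂˣ) : param d F (torusPoint hF hJ b) = fun i => (b i : ℂ) := by
  funext i
  rw [param, pointHomSpz_torusPoint, CommRingCat.hom_ofHom, AlgHom.toRingHom_eq_coe, RingHom.coe_coe, evalAt_X]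

/-- **`S_T ⊆ 𝔸ⁿ⁺²_ℂ` as a `ℂ`-morphism** (the open immersion `S_T ⊆ Spec ℂ[b]` followed by Mathlib's
`AffineSpace.SpecIso`). [cite: SerreGAGA1956, §2 n°5] -/
def baseToAffineSpace : torusBase d F ⟶ affineSpaceOver (Fin (n + 2)) ℂ :=
  Over.homMk ((baseSpzOpens ℂ n d (torusSpz d F)).ι ≫ (AffineSpace.SpecIso (Fin (n + 2)) (.of ℂ)).inv) (by
    change ((baseSpzOpens ℂ n d (torusSpz d F)).ι ≫ (AffineSpace.SpecIso (Fin (n + 2)) (.of ℂ)).inv) ≫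
        (𝔸(Fin (n + 2); Spec (.of ℂ)) ↘ Spec (.of ℂ)) = (torusBase d F).hom
    rw [Category.assoc, AffineSpace.SpecIso_inv_over]
    rfl)

/-- The underlying scheme morphism of `baseToAffineSpace` (`rfl`). [cite: SerreGAGA1956, §2 n°5] -/
theorem baseToAffineSpace_left : (baseToAffineSpace d F).left =
    (baseSpzOpens ℂ n d (torusSpz d F)).ι ≫ (AffineSpace.SpecIso (Fin (n + 2)) (.of ℂ)).inv := rfl

/-- `S_T → 𝔸ⁿ⁺²` is an open immersion. [cite: SerreGAGA1956, §2 n°5] -/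
theorem isOpenImmersion_baseToAffineSpace_left : IsOpenImmersion (baseToAffineSpace d F).left :=
  (inferInstance :
    IsOpenImmersion ((baseSpzOpens ℂ n d (torusSpz d F)).ι ≫ (AffineSpace.SpecIso (Fin (n + 2)) (.of ℂ)).inv))

/-- The coefficient homomorphism of `t` IS evaluation at its parameter vector. [cite: VoisinHodgeII2003, §6.2.1] -/
theorem pointHomSpz_hom_eq_aeval_param (t : ComplexPoints (torusBase d F)) :
    (pointHomSpz ℂ n d (torusSpz d F) t).hom = (MvPolynomial.aeval (param d F t)).toRingHom := by
  rw [pointHomSpz_hom_eq_eval]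
  refine MvPolynomial.ringHom_ext (fun r => ?_) (fun i => ?_)
  · rw [eval_C, AlgHom.toRingHom_eq_coe, RingHom.coe_coe, MvPolynomial.algHom_C, Algebra.algebraMap_self,
      RingHom.id_apply]
  · rw [eval_X, AlgHom.toRingHom_eq_coe, RingHom.coe_coe, MvPolynomial.aeval_X]
    rfl

/-- **Under `S_T → 𝔸ⁿ⁺²`, the point `t` goes to the point of affine space with coordinates its parameter vector.**
[cite: SerreGAGA1956, §2 n°5] -/
theorem map_baseToAffineSpace (t : ComplexPoints (torusBase d F)) :
    AlgPoints.map (baseToAffineSpace d F) t = AlgPoints.affinePoint ℂ (param d F t) := by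
  apply Over.OverMorphism.ext
  have h : CommRingCat.ofHom (MvPolynomial.aeval (param d F t)).toRingHom = pointHomSpz ℂ n d (torusSpz d F) t := by
    ext1; exact (pointHomSpz_hom_eq_aeval_param d F t).symm
  rw [AlgPoints.map_apply, Over.comp_left, baseToAffineSpace_left, AlgPoints.affinePoint_left, h,
    Spec_map_pointHomSpz]
  exact (Category.assoc _ _ _).symm

/-- `param = affineCoords ∘ map baseToAffineSpace`. [cite: SerreGAGA1956, §2 n°5] -/
theorem param_eq_comp : (param d F : ComplexPoints (torusBase d F) → Fin (n + 2) → ℂ) =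
    AlgPoints.affineCoords ∘ AlgPoints.map (baseToAffineSpace d F) :=
  funext fun t => by rw [Function.comp_apply, map_baseToAffineSpace, AlgPoints.affineCoords_affinePoint]

/-- **The parameter chart is continuous** (its entries are global regular functions). [cite: SerreGAGA1956, §2 n°5] -/
theorem continuous_param : Continuous (param d F) := by
  rw [param_eq_comp]
  exact AlgPoints.continuous_affineCoords.comp (AlgPoints.continuous_map _)

/-- **The parameter chart `S_T(ℂ) ↪ ℂⁿ⁺²` is a topological embedding** (open immersions induce embeddings on
`ℂ`-points, `AlgPoints.isEmbedding_map`, and `𝔸ⁿ⁺²(ℂ) ≅ ℂⁿ⁺²`, `isHomeomorph_affineCoords`).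
[cite: SerreGAGA1956, §2 n°5] -/
theorem isEmbedding_param : IsEmbedding (param d F) := by
  rw [param_eq_comp]
  haveI := isOpenImmersion_baseToAffineSpace_left d F
  exact AlgPoints.isHomeomorph_affineCoords.isEmbedding.comp (AlgPoints.isEmbedding_map _)

/-- **Lifting continuous families to `S_T(ℂ)`**: a family of points of `S_T(ℂ)` is continuous as soon as its
parameter vectors are. [cite: SerreGAGA1956, §2 n°5] -/
theorem continuous_of_param_comp {X : Type*} [TopologicalSpace X] {g : X → ComplexPoints (torusBase d F)}
    (hg : Continuous fun x => param d F (g x)) : Continuous g :=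
  (isEmbedding_param d F).continuous_iff.mpr hg

end Chart

/-! ### §4 The torus path `s ↦ [F(b_s • x)]`, `b_s = exp(s · log a)` -/

section TorusPath

variable {n : ℕ} {d : ℕ} {F : MvPolynomial (Fin (n + 2)) ℂ}
  (hF : F.IsHomogeneous d) (hJ : SmoothHypersurface.IsNonsingularForm ℂ F) (a : Fin (n + 2) → ℂˣ)

/-- The one-parameter subgroup `b_s = (exp(s · log aᵢ))ᵢ` of the torus from `1` to `a`. [cite: Katz2009, §3] -/
def expPath (a : Fin (n + 2) → ℂˣ) (s : ℝ) : Fin (n + 2) → ℂˣ :=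
  fun i => Units.mk0 (Complex.exp ((s : ℂ) * Complex.log (a i : ℂ))) (Complex.exp_ne_zero _)

/-- `b_0 = 1`. [cite: Katz2009, §3] -/
theorem expPath_zero : expPath a 0 = 1 := by
  funext i; ext
  rw [expPath, Units.val_mk0, Complex.ofReal_zero, zero_mul, Complex.exp_zero, Pi.one_apply, Units.val_one]

/-- `b_1 = a`. [cite: Katz2009, §3] -/
theorem expPath_one : expPath a 1 = a := by
  funext i; ext
  rw [expPath, Units.val_mk0, Complex.ofReal_one, one_mul, Complex.exp_log (a i).ne_zero]

/-- `s ↦ b_s` is continuous (coordinatewise in `ℂ`). [cite: Katz2009, §3] -/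
theorem continuous_expPath_val : Continuous fun s : ℝ => fun i => ((expPath a s i : ℂˣ) : ℂ) := by
  refine continuous_pi fun i => ?_
  simp only [expPath, Units.val_mk0]
  exact Complex.continuous_exp.comp (Complex.continuous_ofReal.mul continuous_const)

/-- **The torus path** in `S_T(ℂ)` from the point `b = 1` to the point `b = a`: `s ↦ [F(b_s • x)]`, continuous
through the parameter chart. [cite: Katz2009, §3] [cite: SerreGAGA1956, §2 n°5] -/
def torusPath : Path (torusPoint hF hJ 1) (torusPoint hF hJ a) where
  toFun s := torusPoint hF hJ (expPath a s)
  continuous_toFun := by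
    refine continuous_of_param_comp d F ?_
    simp only [param_torusPoint]
    exact (continuous_expPath_val a).comp continuous_subtype_val
  source' := by
    change torusPoint hF hJ (expPath a 0) = _
    rw [torusPoint_congr hF hJ (expPath_zero a)]
  target' := by
    change torusPoint hF hJ (expPath a 1) = _
    rw [torusPoint_congr hF hJ (expPath_one a)]

/-- `torusPath a s` is the point `b_s`. [cite: Katz2009, §3] -/
theorem torusPath_apply (s : unitInterval) : torusPath hF hJ a s = torusPoint hF hJ (expPath a s) := rfl

/-- The torus path viewed in the subspace `Set.univ ⊆ S_T(ℂ)` (the shape consumed by `transportFun`).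
[cite: VoisinHodgeII2003, §3.1.2] -/
def torusPathUniv : Path (⟨torusPoint hF hJ 1, Set.mem_univ _⟩ : (Set.univ : Set (ComplexPoints (torusBase d F))))
    ⟨torusPoint hF hJ a, Set.mem_univ _⟩ :=
  (torusPath hF hJ a).map (continuous_id.subtype_mk fun x => Set.mem_univ x)

/-- `torusPathUniv a s` is the point `b_s`. [cite: Katz2009, §3] -/
theorem torusPathUniv_apply (s : unitInterval) : (torusPathUniv hF hJ a s).1 = torusPoint hF hJ (expPath a s) := rfl

end TorusPath

end DiagonalTorus

end Literature.AlgebraicGeometry.HodgeTheory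

end
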